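import Literature.NumberTheory.Sieve.BombieriFriedlanderIwaniecTheorem9Dyadic
import HarnessLib

/-!
# BFI 1986, Theorem 9 — the balanced discrepancy of `Λ` on a sub-interval of a dyadic range

Topic `Literature/NumberTheory/Sieve`.  Shared vocabulary of the files re-threading Theorem 9 of
E. Bombieri, J. B. Friedlander, H. Iwaniec, *Primes in arithmetic progressions to large moduli*,
Acta Math. 156 (1986), 203–251, through the core case (13.1) `Q²R ≤ x` of Theorem 6 (see
`…Theorem9CoreCaseI`): after the `q ↔ s` switch of §13 (p. 241) is applied to the sums of
Theorem 9 at the level of `Λ` (`…Theorem9SwitchCounting`), the variable `n` of a dyadic range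
`(y, 2y]` comes restricted to sub-intervals `(c₁, c₂]` (the ranges `Q'rs < n − a ≤ 2Q'rs` frozen on
a cell of `(r, s)`), so the dyadic statement (15.1) of §15 has to be carried for sub-intervals.
This file defines that object and records its elementary properties (all PROVED; no named fact is
introduced; `BFI.IvlBoundAt` is a parametrised predicate naming the SHAPE of the bound, in the
manner of `BFI.MomentHyp`):

* `BFI.ivlCongr d a c₁ c₂ y`, `BFI.ivlCop d c₁ c₂ y`, **`BFI.discIvl d a c₁ c₂ y`** — the sums of
  `Λ(n)` over `y < n ≤ 2y`, `c₁ < n ≤ c₂` in the class `n ≡ a (mod d)`, resp. over `(n, d) = 1`, and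
  the balanced discrepancy `ivlCongr − ivlCop/φ(d)` (for `c₁ = y`, `c₂ = 2y` this is the tree's
  `BFI.dyadDisc`, `BFI.dyadDisc_eq_discIvl`);
* `BFI.IvlBoundAt a ε A B C x₀` — the statement "for `y ≥ x₀`, `y ≤ c₁`, `c₂ ≤ 2y`,
  `R < y^{1/10−ε}`, `QR < y ℒ^{−B}`, `Q²R ≤ 8y`, `|δ| ≤ 1`:
  `|∑_{r ≤ R,(r,a)=1} δ_r ∑_{q ≤ Q,(q,a)=1} discIvl(qr; c₁, c₂)| ≤ C y ℒ^{−A}`" — the dyadic-interval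
  form of Theorem 9 in the CORE range `Q²R ≤ 8y` (to be derived from the core case of Theorem 6 and
  Theorem 7*, and to be fed into the switch);
* the interval bookkeeping: `BFI.sum_Ioc_floor_ivl_eq` (the conditions `c₁ < n ≤ c₂` inside
  `(y, 2y]` cut out `(⌊c₁⌋, ⌊c₂⌋]`), `BFI.ivlCop_eq_psi_sub` and **`BFI.abs_ivlCop_sub_length_le`**
  (`|ivlCop − (c₂ − c₁)| ≤ |ψ(c₂) − c₂| + |ψ(c₁) − c₁| + ∑_{n ≤ 2y,(n,d)>1} Λ(n)`), nonnegativity and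
  the empty interval.

## References

* E. Bombieri, J. B. Friedlander, H. Iwaniec, Acta Math. 156 (1986), 203–251: §13 p. 241–242,
  §15 (15.1) p. 244, §16 p. 250. [BombieriFriedlanderIwaniecActa1986]
-/

open Finset Real
open scoped ArithmeticFunction.vonMangoldt Chebyshev

namespace Literature.NumberTheory.Sieve

namespace BFI

/-! ### The sums over `(y, 2y] ∩ (c₁, c₂]` -/

/-- `∑_{y < n ≤ 2y, c₁ < n ≤ c₂, n ≡ a (mod d)} Λ(n)`. [cite: BombieriFriedlanderIwaniecActa1986, §15 (15.1) p. 244] -/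
noncomputable def ivlCongr (d : ℕ) (a : ℤ) (c₁ c₂ y : ℝ) : ℝ :=
  ∑ n ∈ Ioc ⌊y⌋₊ ⌊2 * y⌋₊,
    if (c₁ < (n : ℝ) ∧ (n : ℝ) ≤ c₂) ∧ ((n : ℕ) : ZMod d) = (a : ZMod d) then (Λ n : ℝ) else 0

/-- `∑_{y < n ≤ 2y, c₁ < n ≤ c₂, (n, d) = 1} Λ(n)`. [cite: BombieriFriedlanderIwaniecActa1986, §15 (15.1) p. 244] -/
noncomputable def ivlCop (d : ℕ) (c₁ c₂ y : ℝ) : ℝ :=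
  ∑ n ∈ Ioc ⌊y⌋₊ ⌊2 * y⌋₊, if (c₁ < (n : ℝ) ∧ (n : ℝ) ≤ c₂) ∧ n.Coprime d then (Λ n : ℝ) else 0

/-- **The balanced discrepancy of `Λ` on `(y, 2y] ∩ (c₁, c₂]` at the modulus `d`**:
`∑_{n ≡ a (d)} Λ(n) − φ(d)⁻¹ ∑_{(n,d)=1} Λ(n)` (BFI (15.1), p. 244, with `z = 1`, on a sub-interval).
[cite: BombieriFriedlanderIwaniecActa1986, §15 (15.1) p. 244] -/
noncomputable def discIvl (d : ℕ) (a : ℤ) (c₁ c₂ y : ℝ) : ℝ :=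
  ivlCongr d a c₁ c₂ y - ivlCop d c₁ c₂ y / (Nat.totient d : ℝ)

/-- **The shape of the core dyadic-interval bound** for the residue `a`, exponents `ε, A` and
constants `B, C, x₀`: for `y ≥ x₀`, `y ≤ c₁`, `c₂ ≤ 2y`, all `Q, R` with `R < y^{1/10−ε}`,
`QR < y ℒ^{−B}`, `Q²R ≤ 8y`, and real weights `|δ_r| ≤ 1`,
`|∑_{r ≤ R, (r,a)=1} δ_r ∑_{q ≤ Q, (q,a)=1} discIvl(qr; a; c₁, c₂; y)| ≤ C y ℒ^{−A}` — Theorem 9 in its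
signed dyadic form (`BFI.thm9Signed_of_dyadic`) on a sub-interval, restricted to the core range of
moduli.  A parametrised predicate (the conclusion shape), used as hypothesis and as conclusion.
[cite: BombieriFriedlanderIwaniecActa1986, §15 (15.1) p. 244; §13 (13.1) p. 241] -/
def IvlBoundAt (a : ℤ) (ε A B C x₀ : ℝ) : Prop :=
  ∀ y : ℝ, x₀ ≤ y → ∀ c₁ c₂ : ℝ, y ≤ c₁ → c₂ ≤ 2 * y → ∀ Q R : ℝ,
    R < y ^ (1 / 10 - ε) → Q * R < y / Real.log y ^ B → Q ^ 2 * R ≤ 8 * y →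
    ∀ δ : ℕ → ℝ, (∀ r, |δ r| ≤ 1) →
      |∑ r ∈ (Icc 1 ⌊R⌋₊).filter (fun r : ℕ => IsCoprime (r : ℤ) a),
          δ r * ∑ q ∈ (Icc 1 ⌊Q⌋₊).filter (fun q : ℕ => IsCoprime (q : ℤ) a),
            discIvl (q * r) a c₁ c₂ y| ≤ C * y / Real.log y ^ A

/-! ### Elementary properties -/

/-- `ivlCop ≥ 0`. [folklore] -/
theorem ivlCop_nonneg (d : ℕ) (c₁ c₂ y : ℝ) : 0 ≤ ivlCop d c₁ c₂ y :=
  Finset.sum_nonneg fun n _ => by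
    split_ifs
    · exact ArithmeticFunction.vonMangoldt_nonneg
    · exact le_rfl

/-- `ivlCongr ≥ 0`. [folklore] -/
theorem ivlCongr_nonneg (d : ℕ) (a : ℤ) (c₁ c₂ y : ℝ) : 0 ≤ ivlCongr d a c₁ c₂ y :=
  Finset.sum_nonneg fun n _ => by
    split_ifs
    · exact ArithmeticFunction.vonMangoldt_nonneg
    · exact le_rfl

/-- Every `n ∈ (⌊y⌋, ⌊2y⌋]` satisfies `y < n ≤ 2y` (`y ≥ 0`). [folklore] -/
theorem mem_Ioc_floor_bounds {y : ℝ} (hy : 0 ≤ y) {n : ℕ} (hn : n ∈ Ioc ⌊y⌋₊ ⌊2 * y⌋₊) :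
    y < n ∧ (n : ℝ) ≤ 2 * y := by
  rw [Finset.mem_Ioc] at hn
  exact ⟨Nat.lt_of_floor_lt hn.1, (Nat.cast_le.2 hn.2).trans (Nat.floor_le (by linarith))⟩

/-- For `c₁ = y`, `c₂ = 2y` the interval discrepancy is the dyadic one (`BFI.dyadDisc`).
[cite: BombieriFriedlanderIwaniecActa1986, §15 (15.1) p. 244] -/
theorem dyadDisc_eq_discIvl (d : ℕ) (a : ℤ) {y : ℝ} (hy : 0 ≤ y) :
    dyadDisc d a y = discIvl d a y (2 * y) y := by
  unfold dyadDisc discIvl ivlCongr ivlCop psiDyadMod psiDyadCoprime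
  congr 1
  · refine Finset.sum_congr rfl fun n hn => ?_
    have hb := mem_Ioc_floor_bounds hy hn
    simp only [ArithmeticFunction.vonMangoldt.residueClass, Set.indicator_apply, Set.mem_setOf_eq]
    by_cases h : ((n : ℕ) : ZMod d) = (a : ZMod d)
    · rw [if_pos h, if_pos ⟨hb, h⟩]
    · rw [if_neg h, if_neg (fun h' => h h'.2)]
  · congr 1
    refine Finset.sum_congr rfl fun n hn => ?_
    have hb := mem_Ioc_floor_bounds hy hn
    by_cases h : n.Coprime d
    · rw [if_pos h, if_pos ⟨hb, h⟩]
    · rw [if_neg h, if_neg (fun h' => h h'.2)]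

/-- **The conditions `c₁ < n ≤ c₂` inside `(y, 2y]` cut out `(⌊c₁⌋, ⌊c₂⌋]`**: for `0 ≤ y ≤ c₁` and
`c₂ ≤ 2y`, `∑_{y<n≤2y} [c₁ < n ≤ c₂ ∧ P(n)] f(n) = ∑_{⌊c₁⌋ < n ≤ ⌊c₂⌋} [P(n)] f(n)`. [folklore] -/
theorem sum_Ioc_floor_ivl_eq {y c₁ c₂ : ℝ} (hy : 0 ≤ y) (h₁ : y ≤ c₁) (h₂ : c₂ ≤ 2 * y)
    (P : ℕ → Prop) [DecidablePred P] (f : ℕ → ℝ) :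
    ∑ n ∈ Ioc ⌊y⌋₊ ⌊2 * y⌋₊, (if (c₁ < (n : ℝ) ∧ (n : ℝ) ≤ c₂) ∧ P n then f n else 0) =
      ∑ n ∈ Ioc ⌊c₁⌋₊ ⌊c₂⌋₊, (if P n then f n else 0) := by
  have hc₁ : 0 ≤ c₁ := hy.trans h₁
  rw [← Finset.sum_filter, ← Finset.sum_filter]
  -- both sides are the sum over `{n : c₁ < n ≤ c₂ ∧ P n}`
  have hsets : (Ioc ⌊y⌋₊ ⌊2 * y⌋₊).filter (fun n : ℕ => (c₁ < (n : ℝ) ∧ (n : ℝ) ≤ c₂) ∧ P n) =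
      (Ioc ⌊c₁⌋₊ ⌊c₂⌋₊).filter (fun n : ℕ => P n) := by
    ext n
    simp only [Finset.mem_filter, Finset.mem_Ioc]
    constructor
    · rintro ⟨-, ⟨hn1, hn2⟩, hP⟩
      refine ⟨⟨(Nat.floor_lt hc₁).2 hn1, Nat.le_floor hn2⟩, hP⟩
    · rintro ⟨⟨hn1, hn2⟩, hP⟩
      have hcn : c₁ < n := Nat.lt_of_floor_lt hn1
      have hc₂ : 0 ≤ c₂ := by
        by_contra hneg
        push Not at hneg
        have : ⌊c₂⌋₊ = 0 := Nat.floor_eq_zero.2 (by linarith)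
        omega
      have hnc : (n : ℝ) ≤ c₂ := (Nat.cast_le.2 hn2).trans (Nat.floor_le hc₂)
      refine ⟨⟨?_, ?_⟩, ⟨hcn, hnc⟩, hP⟩
      · exact (Nat.floor_le_floor h₁).trans_lt hn1
      · exact hn2.trans (Nat.floor_le_floor h₂)
  rw [hsets]

/-- `ivlCop` as a sum over `(⌊c₁⌋, ⌊c₂⌋]`. [folklore] -/
theorem ivlCop_eq_sum_Ioc (d : ℕ) {y c₁ c₂ : ℝ} (hy : 0 ≤ y) (h₁ : y ≤ c₁) (h₂ : c₂ ≤ 2 * y) :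
    ivlCop d c₁ c₂ y = ∑ n ∈ Ioc ⌊c₁⌋₊ ⌊c₂⌋₊, (if n.Coprime d then (Λ n : ℝ) else 0) := by
  unfold ivlCop
  exact sum_Ioc_floor_ivl_eq hy h₁ h₂ _ _

/-- `ivlCongr` as a sum over `(⌊c₁⌋, ⌊c₂⌋]`. [folklore] -/
theorem ivlCongr_eq_sum_Ioc (d : ℕ) (a : ℤ) {y c₁ c₂ : ℝ} (hy : 0 ≤ y) (h₁ : y ≤ c₁)
    (h₂ : c₂ ≤ 2 * y) :
    ivlCongr d a c₁ c₂ y =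
      ∑ n ∈ Ioc ⌊c₁⌋₊ ⌊c₂⌋₊, (if ((n : ℕ) : ZMod d) = (a : ZMod d) then (Λ n : ℝ) else 0) := by
  unfold ivlCongr
  exact sum_Ioc_floor_ivl_eq hy h₁ h₂ _ _

/-- The empty interval: for `c₂ ≤ c₁`, `discIvl = 0`. [folklore] -/
theorem discIvl_eq_zero_of_le (d : ℕ) (a : ℤ) {c₁ c₂ : ℝ} (h : c₂ ≤ c₁) (y : ℝ) :
    discIvl d a c₁ c₂ y = 0 := by
  unfold discIvl ivlCongr ivlCop
  have h0 : ∀ n : ℕ, ¬ (c₁ < (n : ℝ) ∧ (n : ℝ) ≤ c₂) := fun n hn => by linarith [hn.1, hn.2]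
  rw [Finset.sum_eq_zero fun n _ => if_neg (fun h' => h0 n h'.1),
    Finset.sum_eq_zero fun n _ => if_neg (fun h' => h0 n h'.1)]
  simp

/-- `∑_{⌊u⌋ < n ≤ ⌊v⌋} Λ(n) = ψ(v) − ψ(u)` for `u ≤ v`. [folklore] -/
theorem sum_Ioc_floor_vonMangoldt_eq_psi_sub {u v : ℝ} (huv : u ≤ v) :
    ∑ n ∈ Ioc ⌊u⌋₊ ⌊v⌋₊, (Λ n : ℝ) = ψ v - ψ u := by
  rw [Chebyshev.psi, Chebyshev.psi, ← Finset.sum_Ioc_consecutive _ (Nat.zero_le ⌊u⌋₊)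
    (Nat.floor_le_floor huv)]
  ring

/-- **The coprime mass of an interval against its length**: for `1 ≤ y ≤ c₁ ≤ c₂ ≤ 2y` and `d ≥ 1`,
`|ivlCop d c₁ c₂ y − (c₂ − c₁)| ≤ |ψ(c₂) − c₂| + |ψ(c₁) − c₁| + ∑_{n ≤ 2y, (n,d) > 1} Λ(n)`
(the last sum is the tree's `nonCoprimePart d (2y) ≤ ⌊log 2y/log 2⌋ log d`). [folklore] -/
theorem abs_ivlCop_sub_length_le {d : ℕ} {y c₁ c₂ : ℝ} (hy : 0 ≤ y) (h₁ : y ≤ c₁) (h₁₂ : c₁ ≤ c₂)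
    (h₂ : c₂ ≤ 2 * y) :
    |ivlCop d c₁ c₂ y - (c₂ - c₁)| ≤
      |ψ c₂ - c₂| + |ψ c₁ - c₁| + Literature.NumberTheory.Sieve.nonCoprimePart d (2 * y) := by
  rw [ivlCop_eq_sum_Ioc d hy h₁ h₂]
  -- split off the non-coprime part
  set N : ℝ := ∑ n ∈ Ioc ⌊c₁⌋₊ ⌊c₂⌋₊, (if n.Coprime d then 0 else (Λ n : ℝ)) with hN
  have hsplit : ∑ n ∈ Ioc ⌊c₁⌋₊ ⌊c₂⌋₊, (if n.Coprime d then (Λ n : ℝ) else 0) =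
      (∑ n ∈ Ioc ⌊c₁⌋₊ ⌊c₂⌋₊, (Λ n : ℝ)) - N := by
    rw [hN, ← Finset.sum_sub_distrib]
    refine Finset.sum_congr rfl fun n _ => ?_
    split_ifs <;> ring
  have hN0 : 0 ≤ N := Finset.sum_nonneg fun n _ => by
    split_ifs
    · exact le_rfl
    · exact ArithmeticFunction.vonMangoldt_nonneg
  have hNle : N ≤ Literature.NumberTheory.Sieve.nonCoprimePart d (2 * y) := by
    rw [hN, Literature.NumberTheory.Sieve.nonCoprimePart, Finset.sum_filter]
    have hsub : Ioc ⌊c₁⌋₊ ⌊c₂⌋₊ ⊆ Finset.range (⌊2 * y⌋₊ + 1) := by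
      intro n hn
      rw [Finset.mem_Ioc] at hn
      rw [Finset.mem_range, Nat.lt_succ_iff]
      exact hn.2.trans (Nat.floor_le_floor h₂)
    refine (Finset.sum_le_sum_of_subset_of_nonneg hsub fun n _ _ => ?_).trans (le_of_eq ?_)
    · split_ifs
      · exact le_rfl
      · exact ArithmeticFunction.vonMangoldt_nonneg
    · refine Finset.sum_congr rfl fun n _ => ?_
      by_cases h : n.Coprime d <;> simp [h]
  rw [hsplit, sum_Ioc_floor_vonMangoldt_eq_psi_sub h₁₂]
  have e : ψ c₂ - ψ c₁ - N - (c₂ - c₁) = (ψ c₂ - c₂) - (ψ c₁ - c₁) - N := by ring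
  rw [e]
  calc |(ψ c₂ - c₂) - (ψ c₁ - c₁) - N| ≤ |(ψ c₂ - c₂) - (ψ c₁ - c₁)| + |N| := abs_sub _ _
    _ ≤ |ψ c₂ - c₂| + |ψ c₁ - c₁| + |N| := by gcongr; exact abs_sub _ _
    _ ≤ _ := by rw [abs_of_nonneg hN0]; gcongr

/-- `ivlCop ≤ ψ(2y) − ψ(y)` (dropping both conditions; for `y ≥ 0`). [folklore] -/
theorem ivlCop_le_psi_sub (d : ℕ) (c₁ c₂ : ℝ) {y : ℝ} (hy : 0 ≤ y) :
    ivlCop d c₁ c₂ y ≤ ψ (2 * y) - ψ y := by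
  rw [← sum_Ioc_floor_vonMangoldt_eq_psi_sub (by linarith : y ≤ 2 * y)]
  unfold ivlCop
  refine Finset.sum_le_sum fun n _ => ?_
  split_ifs
  · exact le_rfl
  · exact ArithmeticFunction.vonMangoldt_nonneg

/-- `ivlCongr ≤ log(2y) · #{y < n ≤ 2y : c₁ < n ≤ c₂, d ∣ n − a}`-type bound: each term is at most
`Λ(n) ≤ log n ≤ log(2y)`, so for any set of conditions the congruence sum is at most `log(2y)`
times the number of admissible `n` (`y ≥ 1`). [folklore] -/
theorem ivlCongr_le_log_mul_card (d : ℕ) (a : ℤ) (c₁ c₂ : ℝ) {y : ℝ} (hy : 1 ≤ y) :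
    ivlCongr d a c₁ c₂ y ≤ Real.log (2 * y) *
      (((Ioc ⌊y⌋₊ ⌊2 * y⌋₊).filter (fun n : ℕ =>
        (c₁ < (n : ℝ) ∧ (n : ℝ) ≤ c₂) ∧ ((n : ℕ) : ZMod d) = (a : ZMod d))).card : ℝ) := by
  unfold ivlCongr
  rw [← Finset.sum_filter]
  have hy0 : 0 ≤ y := zero_le_one.trans hy
  calc ∑ n ∈ (Ioc ⌊y⌋₊ ⌊2 * y⌋₊).filter (fun n : ℕ =>
          (c₁ < (n : ℝ) ∧ (n : ℝ) ≤ c₂) ∧ ((n : ℕ) : ZMod d) = (a : ZMod d)), (Λ n : ℝ)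
      ≤ ∑ n ∈ (Ioc ⌊y⌋₊ ⌊2 * y⌋₊).filter (fun n : ℕ =>
          (c₁ < (n : ℝ) ∧ (n : ℝ) ≤ c₂) ∧ ((n : ℕ) : ZMod d) = (a : ZMod d)), Real.log (2 * y) := by
        refine Finset.sum_le_sum fun n hn => ?_
        have hb := mem_Ioc_floor_bounds hy0 (Finset.mem_filter.1 hn).1
        have hn0 : (0 : ℝ) < n := by linarith
        calc (Λ n : ℝ) ≤ Real.log n := ArithmeticFunction.vonMangoldt_le_log
          _ ≤ Real.log (2 * y) := Real.log_le_log hn0 hb.2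
    _ = _ := by rw [Finset.sum_const, nsmul_eq_mul, mul_comm]

end BFI

end Literature.NumberTheory.Sieve
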